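import Mathlib

/-!
# ValiantsHypothesis / BinomialElusive — sharpness example for crux `BinomialMapsElusive`

Support file for `stmt-ValiantsHypothesis-7393`.  The crux asserts that binomial quadratic maps
`ℂ^{m-1} → ℂ^m` do not swallow the route's E-curve, whose exponents admit no short integer relations.
Some hypothesis on the exponents beyond "distinct gaps" (which suffices in the TORIC case, support
7394, and in the translated-toric case, `affineMonomialMapsElusive`) is NECESSARY for genuine binomial
maps: the binomial quadratic map
`Γ(y) = (y₀ + y₀², y₁ + y₁², y₀y₁ + y₂, y₀y₂ + y₂²) : ℂ³ → ℂ⁴`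
swallows the binomial curve `x ↦ (x + x², x³ + x⁶, x⁴ + x⁹, x¹⁰ + x¹⁸)` (pairwise distinct exponents
`1,2,3,6,4,9,10,18`, pairwise distinct gaps `1,3,5,8`) through the monomial substitution `y = (x, x³, x⁹)`
— it lives on the short exponent relations `4 = 1 + 3`, `10 = 1 + 9`, `9 = 3·3`, `18 = 2·9`
(STRUCTURE-p1 §3 of the crux directory, first prover; kernel-checked here).  So any proof of the crux
must use the absence of SHORT relations among the `E(j)`: it is a "force a short relation" theorem,
not a pure rigidity theorem.
-/

namespace Summit.ValiantsHypothesis.ValiantsHypothesis.Theorems.BinomialElusiveSharpness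

-- summit = sub-problem name (single-conjunct summit, D-0017 layout), so the namespace repeats it
set_option linter.dupNamespace false

open MvPolynomial

/-- A sum of two monomials has at most two monomials in its support. -/
theorem card_support_monomial_add_le (s t : Fin 3 →₀ ℕ) (a b : ℂ) :
    ((monomial s a) + monomial t b).support.card ≤ 2 := by
  classical
  refine (Finset.card_le_card (support_add (p := monomial s a) (q := monomial t b))).trans ?_
  refine (Finset.card_union_le _ _).trans ?_
  have h1 := Finset.card_le_card (support_monomial_subset (s := s) (a := a))
  have h2 := Finset.card_le_card (support_monomial_subset (s := t) (a := b))
  simp only [Finset.card_singleton] at h1 h2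
  omega

/-- `X j` as a monomial. -/
theorem X_eq_monomial' (j : Fin 3) : (X j : MvPolynomial (Fin 3) ℂ) = monomial (Finsupp.single j 1) 1 := rfl

/-- `X j * X k` as a monomial. -/
theorem X_mul_X_eq_monomial (j k : Fin 3) :
    (X j : MvPolynomial (Fin 3) ℂ) * X k = monomial (Finsupp.single j 1 + Finsupp.single k 1) 1 := by
  rw [X_eq_monomial', X_eq_monomial', monomial_mul, one_mul]

/-- Total degree and support bounds for the four coordinates. -/
theorem g0_deg : (X 0 + X 0 ^ 2 : MvPolynomial (Fin 3) ℂ).totalDegree ≤ 2 ∧ (X 0 + X 0 ^ 2 : MvPolynomial (Fin 3) ℂ).support.card ≤ 2 := by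
  refine ⟨(totalDegree_add _ _).trans (max_le ((totalDegree_X (R := ℂ) (0 : Fin 3)).le.trans one_le_two)
    (by rw [totalDegree_X_pow])), ?_⟩
  rw [X_pow_eq_monomial, X_eq_monomial']; exact card_support_monomial_add_le _ _ _ _

/-- Total degree and support bounds for `g1`. -/
theorem g1_deg : (X 1 + X 1 ^ 2 : MvPolynomial (Fin 3) ℂ).totalDegree ≤ 2 ∧ (X 1 + X 1 ^ 2 : MvPolynomial (Fin 3) ℂ).support.card ≤ 2 := by
  refine ⟨(totalDegree_add _ _).trans (max_le ((totalDegree_X (R := ℂ) (1 : Fin 3)).le.trans one_le_two)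
    (by rw [totalDegree_X_pow])), ?_⟩
  rw [X_pow_eq_monomial, X_eq_monomial']; exact card_support_monomial_add_le _ _ _ _

/-- Total degree and support bounds for `g2`. -/
theorem g2_deg : (X 0 * X 1 + X 2 : MvPolynomial (Fin 3) ℂ).totalDegree ≤ 2 ∧ (X 0 * X 1 + X 2 : MvPolynomial (Fin 3) ℂ).support.card ≤ 2 := by
  refine ⟨(totalDegree_add _ _).trans (max_le ((totalDegree_mul _ _).trans (by
    rw [totalDegree_X, totalDegree_X])) ((totalDegree_X (R := ℂ) (2 : Fin 3)).le.trans one_le_two)), ?_⟩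
  rw [X_mul_X_eq_monomial, X_eq_monomial' 2]; exact card_support_monomial_add_le _ _ _ _

/-- Total degree and support bounds for `g3`. -/
theorem g3_deg : (X 0 * X 2 + X 2 ^ 2 : MvPolynomial (Fin 3) ℂ).totalDegree ≤ 2 ∧ (X 0 * X 2 + X 2 ^ 2 : MvPolynomial (Fin 3) ℂ).support.card ≤ 2 := by
  refine ⟨(totalDegree_add _ _).trans (max_le ((totalDegree_mul _ _).trans (by
    rw [totalDegree_X, totalDegree_X])) (by rw [totalDegree_X_pow])), ?_⟩
  rw [X_mul_X_eq_monomial, X_pow_eq_monomial]; exact card_support_monomial_add_le _ _ _ _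

/-- Every coordinate of `Γ = (y₀ + y₀², y₁ + y₁², y₀y₁ + y₂, y₀y₂ + y₂²)` has total degree `≤ 2` and at
most two monomials. -/
theorem gammaEx_deg : ∀ i, ((![X 0 + X 0 ^ 2, X 1 + X 1 ^ 2, X 0 * X 1 + X 2, X 0 * X 2 + X 2 ^ 2] : Fin 4 → MvPolynomial (Fin 3) ℂ) i).totalDegree ≤ 2 ∧
    ((![X 0 + X 0 ^ 2, X 1 + X 1 ^ 2, X 0 * X 1 + X 2, X 0 * X 2 + X 2 ^ 2] : Fin 4 → MvPolynomial (Fin 3) ℂ) i).support.card ≤ 2 := by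
  intro i
  fin_cases i
  · exact g0_deg
  · exact g1_deg
  · exact g2_deg
  · exact g3_deg

/-- The monomial substitution `y = (x, x³, x⁹)` realises the curve point over `x`. -/
theorem eval_gammaEx (x : ℂ) :
    (fun i => eval ![x, x ^ 3, x ^ 9] ((![X 0 + X 0 ^ 2, X 1 + X 1 ^ 2, X 0 * X 1 + X 2, X 0 * X 2 + X 2 ^ 2] : Fin 4 → MvPolynomial (Fin 3) ℂ) i))
      = ![x ^ 1 + x ^ 2, x ^ 3 + x ^ 6, x ^ 4 + x ^ 9, x ^ 10 + x ^ 18] := by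
  funext i
  fin_cases i
  · show eval ![x, x ^ 3, x ^ 9] (X 0 + X 0 ^ 2 : MvPolynomial (Fin 3) ℂ) = x ^ 1 + x ^ 2
    simp
  · show eval ![x, x ^ 3, x ^ 9] (X 1 + X 1 ^ 2 : MvPolynomial (Fin 3) ℂ) = x ^ 3 + x ^ 6
    simp; ring
  · show eval ![x, x ^ 3, x ^ 9] (X 0 * X 1 + X 2 : MvPolynomial (Fin 3) ℂ) = x ^ 4 + x ^ 9
    simp; ring
  · show eval ![x, x ^ 3, x ^ 9] (X 0 * X 2 + X 2 ^ 2 : MvPolynomial (Fin 3) ℂ) = x ^ 10 + x ^ 18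
    simp; ring

/-- **Sharpness.**  A binomial quadratic map `ℂ³ → ℂ⁴` (total degree `≤ 2`, `≤ 2` monomials per
coordinate) whose image contains a binomial curve with pairwise distinct exponents and pairwise
distinct gaps: "distinct gaps" alone does not make binomial curves elude binomial maps from fewer
variables (contrast `ToricBinomialElusive`, `translatedToricBinomialElusive`). -/
theorem binomialMap_swallows_binomialCurve :
    ∃ Γ : Fin 4 → MvPolynomial (Fin 3) ℂ, (∀ i, (Γ i).totalDegree ≤ 2) ∧ (∀ i, (Γ i).support.card ≤ 2) ∧
      Set.range (fun x : ℂ => (![x ^ 1 + x ^ 2, x ^ 3 + x ^ 6, x ^ 4 + x ^ 9, x ^ 10 + x ^ 18] : Fin 4 → ℂ))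
        ⊆ Set.range (fun y : Fin 3 → ℂ => fun i : Fin 4 => eval y (Γ i)) := by
  refine ⟨(![X 0 + X 0 ^ 2, X 1 + X 1 ^ 2, X 0 * X 1 + X 2, X 0 * X 2 + X 2 ^ 2] : Fin 4 → MvPolynomial (Fin 3) ℂ),
    fun i => (gammaEx_deg i).1, fun i => (gammaEx_deg i).2, ?_⟩
  rintro _ ⟨x, rfl⟩
  exact ⟨![x, x ^ 3, x ^ 9], eval_gammaEx x⟩

end Summit.ValiantsHypothesis.ValiantsHypothesis.Theorems.BinomialElusiveSharpness
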